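import Literature.NumberTheory.Automorphic.ArchKirillovStringGL2Complex
import Literature.Analysis.Complex.PolyaBesselOrderRecurrence
import HarnessLib

/-!
# The Kirillov functions along a minimal-type `SU(2)`-string of `GL₂(K_∞)` at a complex place are
# single `K`-Bessel functions of shifting order (Jacquet–Langlands (1970), §6)

Topic `NumberTheory/Automorphic`; namespace `Literature.NumberTheory.Automorphic`. Theorems only (no
definition, no named fact, no instance). Let `x` be a highest-weight Gårding vector of torus weight `m`
at a complex place `w` (`E x = 0`, `τ(T) x = im x`) of a representation on which the centre of the
place acts by `μ₁, μ₂` and the antiholomorphic / holomorphic Casimirs by `λ_a, λ_h`. By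
`ArchKirillovODEGL2ComplexKType.exists_apply_gardingAct_expGLC_eq_besselMode_of_highest`,
`ℓ(τ(exp yH) x) = c e^{(μ₁+m+1)y/2} besselMode a ν (e^y)` with `λ_a = (μ₁+iμ₂)²/2 - 2ν² - 2`. If
moreover the string is of **minimal type**, i.e.

  `λ_h = (μ₁ - iμ₂)²/2 - 2(ν - im)² - 2`,

then every member `F^j x` of the `SU(2)`-string has the single-Bessel Kirillov function

  `ℓ(τ(exp yH) F^j x) = c ∏_{i<j} (-2(m-i)(θ₁+iθ₂)/a) · e^{(μ₁+m+1)y/2} · besselMode a (ν - ij) (e^y)`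

(`exists_forall_apply_loweringK_pow_eq_besselMode`): the order of the Bessel function shifts by
`-i` at each step and the power of `e^y` stays fixed. Proof: induction on `j`, the downward recursion
`ArchKirillovStringGL2Complex.kirillovODE_complex_string_down` expressing `ℓ(τ(exp yH) F^{j+1} x)`
through `f = ℓ(τ(exp yH) F^j x)`, `f'`, `f''`, and the order recurrence
`besselMode a (w - i) = ((1/2 + iw)/(aY)) besselMode a w - a⁻¹ besselMode₁ a w`
(`PolyaBesselOrderRecurrence.besselMode_sub_I`); the coefficient identities (`string_step_algebra`)
are where the minimal-type relation enters. (Symbolic verification: kit jobs j021964, j022065.)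

## References

* H. Jacquet, R. P. Langlands, *Automorphic Forms on GL(2)*, LNM 114 (1970), §6. [JacquetLanglands1970]
* A. W. Knapp, *Representation Theory of Semisimple Groups* (1986), Ch. VIII §3. [Knapp1986]
-/

noncomputable section

open MeasureTheory Measure NumberField NumberField.InfinitePlace NumberField.mixedEmbedding IsDedekindDomain Set Filter
open scoped MatrixGroups Topology Classical

namespace Literature.NumberTheory.Automorphic

variable {K : Type} [Field K] [NumberField K]

-- as in `ArchGardingWhittaker`
set_option backward.isDefEq.respectTransparency false

/-! ### 1. Calculus of `y ↦ e^{κy} besselMode a w (e^y)` -/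

section Calculus

open Literature.Analysis.Complex

/-- `(e^y)^κ = e^{κ y}` for real `y` (complex power of a positive real). [folklore] -/
theorem ofReal_exp_cpow (y : ℝ) (κ : ℂ) : ((Real.exp y : ℝ) : ℂ) ^ κ = Complex.exp (κ * y) := by
  rw [Complex.ofReal_exp, Complex.cpow_def_of_ne_zero (Complex.exp_ne_zero _), Complex.log_exp (by simp [Real.pi_pos]) (by simp [Real.pi_pos.le]),
    mul_comm]

/-- **Derivative of `y ↦ (e^y)^κ besselMode a w (e^y)`**:
`κ (e^y)^κ besselMode + (e^y)^κ e^y besselMode₁`. [folklore] -/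
theorem hasDerivAt_cpow_mul_besselMode_exp {a : ℝ} (ha : 0 < a) (κ w : ℂ) (y : ℝ) :
    HasDerivAt (fun t : ℝ => ((Real.exp t : ℝ) : ℂ) ^ κ * besselMode a w (Real.exp t))
      (κ * ((Real.exp y : ℝ) : ℂ) ^ κ * besselMode a w (Real.exp y) +
        ((Real.exp y : ℝ) : ℂ) ^ κ * (Real.exp y : ℂ) * besselMode₁ a w (Real.exp y)) y := by
  have h1 : HasDerivAt (fun t : ℝ => ((Real.exp t : ℝ) : ℂ) ^ κ) (κ * ((Real.exp y : ℝ) : ℂ) ^ κ) y := by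
    have hfun : (fun t : ℝ => ((Real.exp t : ℝ) : ℂ) ^ κ) = fun t : ℝ => Complex.exp (κ * t) := by
      funext t; exact ofReal_exp_cpow t κ
    rw [hfun, ofReal_exp_cpow]
    have h : HasDerivAt (fun t : ℝ => κ * (t : ℂ)) (κ * 1) y := ((hasDerivAt_id y).ofReal_comp).const_mul κ
    simpa [mul_comm] using h.cexp
  have h2 : HasDerivAt (fun t : ℝ => besselMode a w (Real.exp t)) (Real.exp y • besselMode₁ a w (Real.exp y)) y :=
    (hasDerivAt_besselMode w (Real.exp_pos y) ha).scomp y (Real.hasDerivAt_exp y)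
  refine (h1.mul h2).congr_deriv ?_
  rw [Complex.real_smul]
  push_cast
  ring

/-- **Second derivative**: the derivative of
`y ↦ κ ((e^y)^κ besselMode) + (e^y)^κ e^y besselMode₁` is
`κ² (e^y)^κ bm + (2κ+1) (e^y)^κ e^y bm₁ + (e^y)^κ (e^y)² (a² - (w² + 1/4)/(e^y)²) bm`. [folklore] -/
theorem hasDerivAt_cpow_mul_besselMode_exp₁ {a : ℝ} (ha : 0 < a) (κ w : ℂ) (y : ℝ) :
    HasDerivAt (fun t : ℝ => κ * (((Real.exp t : ℝ) : ℂ) ^ κ * besselMode a w (Real.exp t)) +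
        ((Real.exp t : ℝ) : ℂ) ^ κ * (Real.exp t : ℂ) * besselMode₁ a w (Real.exp t))
      (κ ^ 2 * ((Real.exp y : ℝ) : ℂ) ^ κ * besselMode a w (Real.exp y) +
        (2 * κ + 1) * ((Real.exp y : ℝ) : ℂ) ^ κ * (Real.exp y : ℂ) * besselMode₁ a w (Real.exp y) +
          ((Real.exp y : ℝ) : ℂ) ^ κ * (Real.exp y : ℂ) ^ 2 *
            (((a : ℂ) ^ 2 - (w ^ 2 + 1 / 4) / (Real.exp y : ℂ) ^ 2) * besselMode a w (Real.exp y))) y := by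
  have hA := (hasDerivAt_cpow_mul_besselMode_exp ha κ w y).const_mul κ
  -- the second summand: `(e^t)^κ e^t = (e^t)^(κ+1)`-free treatment as a triple product
  have h1 : HasDerivAt (fun t : ℝ => ((Real.exp t : ℝ) : ℂ) ^ κ) (κ * ((Real.exp y : ℝ) : ℂ) ^ κ) y := by
    have hfun : (fun t : ℝ => ((Real.exp t : ℝ) : ℂ) ^ κ) = fun t : ℝ => Complex.exp (κ * t) := by
      funext t; exact ofReal_exp_cpow t κ
    rw [hfun, ofReal_exp_cpow]
    have h : HasDerivAt (fun t : ℝ => κ * (t : ℂ)) (κ * 1) y := ((hasDerivAt_id y).ofReal_comp).const_mul κ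
    simpa [mul_comm] using h.cexp
  have h2 : HasDerivAt (fun t : ℝ => (Real.exp t : ℂ)) (Real.exp y : ℂ) y := (Real.hasDerivAt_exp y).ofReal_comp
  have h3 : HasDerivAt (fun t : ℝ => besselMode₁ a w (Real.exp t))
      (Real.exp y • (((a : ℂ) ^ 2 - (w ^ 2 + 1 / 4) / (Real.exp y : ℂ) ^ 2) * besselMode a w (Real.exp y))) y :=
    (hasDerivAt_besselMode₁ w (Real.exp_pos y) ha).scomp y (Real.hasDerivAt_exp y)
  have hB := (h1.mul h2).mul h3
  refine (hA.add hB).congr_deriv ?_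
  rw [Complex.real_smul]
  simp only [Pi.mul_apply]
  push_cast
  ring

/-- **The coefficient identities of the induction step** (pure algebra). With `κ = (μ₁+m+1)/2`,
`w = ν - ij`, `m' = m - 2j`, `θ^h θ^a = -a²`, `λ = (μ₁-iμ₂)²/2 - 2(ν - im)² - 2`, and arbitrary values
`bm, bm₁` (standing for `besselMode a w (e^y)`, `besselMode₁ a w (e^y)`) and `P` (standing for `(e^y)^κ`):

  `-(2 G₂ - (2μ₁ - 2m' + 4) G₁ + c₀ G₀ + 2 θ^h θ^a Y² G₀)
     = 2 θ^h Y · (-2(m-j) θ^a / a) · P (((1/2 + iw)/(aY)) bm - a⁻¹ bm₁)`,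

where `G₀ = P bm`, `G₁ = κ P bm + P Y bm₁`, `G₂ = κ² P bm + (2κ+1) P Y bm₁ + P Y² (a² - (w² + 1/4)/Y²) bm`
and `c₀` is the constant of `kirillovODE_complex_string_down` for the weight `m'`. [folklore] -/
theorem string_step_algebra {μ₁ μ₂ ν θh θa a m j Y P bm bm₁ κ w m' lam G₀ G₁ G₂ : ℂ} (ha : a ≠ 0)
    (hθ : θh * θa = -(a ^ 2)) (hY : Y ≠ 0) (hκ : κ = (μ₁ + m + 1) / 2) (hw : w = ν - Complex.I * j)
    (hm' : m' = m - 2 * j) (hlam : lam = (μ₁ - Complex.I * μ₂) ^ 2 / 2 - 2 * (ν - Complex.I * m) ^ 2 - 2)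
    (hG₀ : G₀ = P * bm) (hG₁ : G₁ = κ * P * bm + P * Y * bm₁)
    (hG₂ : G₂ = κ ^ 2 * P * bm + (2 * κ + 1) * P * Y * bm₁ + P * Y ^ 2 * ((a ^ 2 - (w ^ 2 + 1 / 4) / Y ^ 2) * bm)) :
    -(2 * G₂ - (2 * μ₁ - 2 * m' + 4) * G₁ +
        (μ₁ ^ 2 - Complex.I * μ₁ * μ₂ - μ₂ ^ 2 / 2 + 2 * μ₁ + m' ^ 2 / 2 - μ₁ * m' - 2 * m' - lam) * G₀ +
          2 * (θh * θa) * Y ^ 2 * G₀) =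
      2 * θh * Y * ((-2 * (m - j) * θa / a) * (P * (((1 / 2 + Complex.I * w) / (a * Y)) * bm - (1 / a) * bm₁))) := by
  -- the two coefficient identities
  have hCB1 : 4 * κ - 2 * μ₁ + 2 * m' - 2 - 4 * (m - j) = 0 := by rw [hκ, hm']; ring
  have hCB : 2 * κ ^ 2 - 2 * w ^ 2 - 1 / 2 - (2 * μ₁ - 2 * m' + 4) * κ +
      (μ₁ ^ 2 - Complex.I * μ₁ * μ₂ - μ₂ ^ 2 / 2 + 2 * μ₁ + m' ^ 2 / 2 - μ₁ * m' - 2 * m' - lam) +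
        4 * (m - j) * (1 / 2 + Complex.I * w) = 0 := by
    rw [hκ, hw, hm', hlam]
    have hI := Complex.I_sq
    linear_combination (2 * (m - j) ^ 2 - μ₂ ^ 2 / 2) * hI
  -- eliminate `θ^h, θ^a` through `θ^h θ^a = -a²`
  have hR : 2 * θh * Y * ((-2 * (m - j) * θa / a) * (P * (((1 / 2 + Complex.I * w) / (a * Y)) * bm - (1 / a) * bm₁))) =
      (θh * θa) * ((-4 * (m - j) * Y / a) * (P * (((1 / 2 + Complex.I * w) / (a * Y)) * bm - (1 / a) * bm₁))) := by ring
  rw [hR, hθ, hG₀, hG₁, hG₂, ← sub_eq_zero]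
  have key : -(2 * (κ ^ 2 * P * bm + (2 * κ + 1) * P * Y * bm₁ + P * Y ^ 2 * ((a ^ 2 - (w ^ 2 + 1 / 4) / Y ^ 2) * bm)) -
        (2 * μ₁ - 2 * m' + 4) * (κ * P * bm + P * Y * bm₁) +
        (μ₁ ^ 2 - Complex.I * μ₁ * μ₂ - μ₂ ^ 2 / 2 + 2 * μ₁ + m' ^ 2 / 2 - μ₁ * m' - 2 * m' - lam) * (P * bm) +
          2 * -a ^ 2 * Y ^ 2 * (P * bm)) -
      -a ^ 2 * (-4 * (m - j) * Y / a * (P * ((1 / 2 + Complex.I * w) / (a * Y) * bm - 1 / a * bm₁))) =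
      -(P * bm) * (2 * κ ^ 2 - 2 * w ^ 2 - 1 / 2 - (2 * μ₁ - 2 * m' + 4) * κ +
          (μ₁ ^ 2 - Complex.I * μ₁ * μ₂ - μ₂ ^ 2 / 2 + 2 * μ₁ + m' ^ 2 / 2 - μ₁ * m' - 2 * m' - lam) +
            4 * (m - j) * (1 / 2 + Complex.I * w)) -
        (P * Y * bm₁) * (4 * κ - 2 * μ₁ + 2 * m' - 2 - 4 * (m - j)) := by
    field_simp
    ring
  rw [key, hCB, hCB1, mul_zero, mul_zero, sub_zero]

end Calculus

/-! ### 2. The Kirillov functions along a minimal-type string -/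

section Bessel

variable {hcpt : isCompact_glFiniteIntegralLevel 2 K}
  {E : Type*} [NormedAddCommGroup E] [NormedSpace ℂ E] [CompleteSpace E]
  {τ : ContRepresentation ℂ (AutomorphyDatum.gl 2 K hcpt).arch.carrier E}
  (hτ : τ.IsStronglyContinuous) (w : {w : InfinitePlace K // IsComplex w})

local notation "𝐜" => ((0, Pi.single w 1) : mixedSpace K)
local notation "𝐜I" => ((0, Pi.single w Complex.I) : mixedSpace K)
local notation "Hc" => Matrix.single (0 : Fin 2) (0 : Fin 2) ((0, Pi.single w 1) : mixedSpace K)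
local notation "D" => gardingEnd (hcpt := hcpt) (τ := τ) hτ
local notation "A[" y "]" => gardingAct (hcpt := hcpt) (τ := τ) hτ (expGL ((y : ℝ) • Hc))
local notation "Dh[" i "," j "]" => (gardingEnd (hcpt := hcpt) (τ := τ) hτ (Matrix.single (i : Fin 2) (j : Fin 2) ((0, Pi.single w 1) : mixedSpace K)) -
  Complex.I • gardingEnd (hcpt := hcpt) (τ := τ) hτ (Matrix.single (i : Fin 2) (j : Fin 2) ((0, Pi.single w Complex.I) : mixedSpace K)))
local notation "Da[" i "," j "]" => (gardingEnd (hcpt := hcpt) (τ := τ) hτ (Matrix.single (i : Fin 2) (j : Fin 2) ((0, Pi.single w 1) : mixedSpace K)) +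
  Complex.I • gardingEnd (hcpt := hcpt) (τ := τ) hτ (Matrix.single (i : Fin 2) (j : Fin 2) ((0, Pi.single w Complex.I) : mixedSpace K)))
local notation "Tc" => (Matrix.single (0 : Fin 2) (0 : Fin 2) ((0, Pi.single w Complex.I) : mixedSpace K) -
  Matrix.single (1 : Fin 2) (1 : Fin 2) ((0, Pi.single w Complex.I) : mixedSpace K))

/-- **The Kirillov functions along a minimal-type `SU(2)`-string are single `K`-Bessel functions.**
Let `x` be a highest-weight Gårding vector of torus weight `m ∈ ℕ` at the complex place `w`
(`E x = 0`, `τ(T) x = im x`); suppose the centre of the place acts on the Gårding space by `μ₁, μ₂`,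
the antiholomorphic and holomorphic Casimirs by `λ_a = (μ₁+iμ₂)²/2 - 2ν² - 2` and
`λ_h = (μ₁-iμ₂)²/2 - 2(ν - im)² - 2` (the *minimal-type relation*), `τ` acts by contractions, `ℓ` is
continuous for the `U(𝔤)`-seminorms with `ℓ ∘ τ(E₀₁ ⊗ c) = θ₁ ℓ`, `ℓ ∘ τ(E₀₁ ⊗ ic) = θ₂ ℓ`,
`(θ₁+iθ₂)(θ₁-iθ₂) = -a²` (`a > 0`). Then there is `c ∈ ℂ` with, for every `j ∈ ℕ` and `y ∈ ℝ`,

  `ℓ(τ(exp yH) F^j x) = c ∏_{i<j} (-2(m-i)(θ₁+iθ₂)/a) · (e^y)^{(μ₁+m+1)/2} · besselMode a (ν - ij) (e^y)`,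

`F = τ^h(E₁₀) - τ^a(E₀₁)`. [cite: JacquetLanglands1970, §6] [cite: Knapp1986, Ch. VIII §3] -/
theorem exists_forall_apply_loweringK_pow_eq_besselMode (hτb : ∀ g, ‖(τ g : E →L[ℂ] E)‖ ≤ 1)
    {ℓ : archGardingSpace hcpt τ →ₗ[ℂ] ℂ}
    (hℓ : ∃ (C : ℝ) (𝒮 : Finset (List (Matrix (Fin 2) (Fin 2) (mixedSpace K)))), 0 ≤ C ∧
      ∀ v : archGardingSpace hcpt τ, ‖ℓ v‖ ≤ C * ∑ w ∈ 𝒮, ‖archWordDerivE hcpt τ w v‖)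
    {θ₁ θ₂ : ℂ} (hθ₁ : ∀ u : archGardingSpace hcpt τ, ℓ (D (Matrix.single 0 1 𝐜) u) = θ₁ * ℓ u)
    (hθ₂ : ∀ u : archGardingSpace hcpt τ, ℓ (D (Matrix.single 0 1 𝐜I) u) = θ₂ * ℓ u)
    {a : ℝ} (ha : 0 < a) (hθa : (θ₁ + Complex.I * θ₂) * (θ₁ - Complex.I * θ₂) = -((a : ℂ) ^ 2))
    (μ₁ μ₂ : ℂ) (m : ℕ) (lama lamh ν : ℂ) (hlama : lama = (μ₁ + Complex.I * μ₂) ^ 2 / 2 - 2 * ν ^ 2 - 2)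
    (hlamh : lamh = (μ₁ - Complex.I * μ₂) ^ 2 / 2 - 2 * (ν - Complex.I * m) ^ 2 - 2)
    (x : archGardingSpace hcpt τ) (hE : (Dh[0,1] - Da[1,0]) x = 0) (hT : D Tc x = (Complex.I * m) • x)
    (hZ1 : ∀ v : archGardingSpace hcpt τ, D (Matrix.single 0 0 𝐜 + Matrix.single 1 1 𝐜) v = μ₁ • v)
    (hZ2 : ∀ v : archGardingSpace hcpt τ, D (Matrix.single 0 0 𝐜I + Matrix.single 1 1 𝐜I) v = μ₂ • v)
    (hCa : ∑ i : Fin 2, ∑ j : Fin 2, Da[i,j] (Da[j,i] x) = lama • x)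
    (hCh : ∀ v : archGardingSpace hcpt τ, ∑ i : Fin 2, ∑ j : Fin 2, Dh[i,j] (Dh[j,i] v) = lamh • v) :
    ∃ c : ℂ, ∀ j : ℕ, ∀ y : ℝ, ℓ (A[y] (((Dh[1,0] - Da[0,1]) ^ j) x)) =
      c * (∏ i ∈ Finset.range j, (-2 * ((m : ℂ) - i) * (θ₁ + Complex.I * θ₂) / a)) *
        (Real.exp y : ℂ) ^ (((μ₁ : ℂ) + m + 1) / 2) * besselMode a (ν - Complex.I * j) (Real.exp y) := by
  -- `j = 0`: the highest-weight vector itself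
  have hR : D (Matrix.single 0 1 𝐜 - Matrix.single 1 0 𝐜) x - Complex.I • D (Matrix.single 0 1 𝐜I + Matrix.single 1 0 𝐜I) x = 0 := by
    have h := LinearMap.congr_fun (raisingK_loweringK_eq (hcpt := hcpt) (τ := τ) hτ w).1 x
    rw [hE] at h
    rw [LinearMap.sub_apply, LinearMap.smul_apply] at h
    exact h.symm
  obtain ⟨c, hc⟩ := exists_apply_gardingAct_expGLC_eq_besselMode_of_highest hτ w hτb hℓ hθ₁ hθ₂ ha hθa μ₁ μ₂ m lama ν
    hlama x hR hT (hZ1 x) (hZ2 x) hCa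
  refine ⟨c, fun j => ?_⟩
  induction j with
  | zero =>
    intro y
    rw [pow_zero, Module.End.one_apply, hc y, Finset.range_zero, Finset.prod_empty, mul_one]
    push_cast
    rw [mul_zero, sub_zero]
  | succ j ih =>
    intro y
    -- abbreviations
    set v : archGardingSpace hcpt τ := ((Dh[1,0] - Da[0,1]) ^ j) x with hv
    set cj : ℂ := c * ∏ i ∈ Finset.range j, (-2 * ((m : ℂ) - i) * (θ₁ + Complex.I * θ₂) / a) with hcj
    set κ : ℂ := ((μ₁ : ℂ) + m + 1) / 2 with hκ
    set wj : ℂ := ν - Complex.I * j with hwj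
    have hvs : ((Dh[1,0] - Da[0,1]) ^ (j + 1)) x = (Dh[1,0] - Da[0,1]) v := by
      rw [pow_succ', Module.End.mul_apply]
    -- the recursion
    have hTv : D Tc v = (Complex.I * ((m : ℂ) - 2 * j)) • v := torusC_loweringK_pow_apply hτ w m x hT j
    have hrec := kirillovODE_complex_string_down hτ w hθ₁ hθ₂ μ₁ μ₂ ((m : ℂ) - 2 * j) lamh v ((Dh[1,0] - Da[0,1]) v) rfl hTv
      (hZ1 v) (hZ2 v) (hCh v) y
    -- the derivatives of `f = ℓ(τ(exp yH) v)`
    have hf : ∀ t : ℝ, ℓ (A[t] v) = cj * (((Real.exp t : ℝ) : ℂ) ^ κ * besselMode a wj (Real.exp t)) := fun t => by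
      rw [ih t]; ring
    have hf₁ : ∀ t : ℝ, ℓ (A[t] (D Hc v)) = cj * (κ * ((Real.exp t : ℝ) : ℂ) ^ κ * besselMode a wj (Real.exp t) +
        ((Real.exp t : ℝ) : ℂ) ^ κ * (Real.exp t : ℂ) * besselMode₁ a wj (Real.exp t)) := fun t => by
      have h1 : HasDerivAt (fun s : ℝ => ℓ (A[s] v)) (ℓ (A[t] (D Hc v))) t := hasDerivAt_apply_gardingAct_expGLC hτ w hℓ v t
      have h2 : HasDerivAt (fun s : ℝ => ℓ (A[s] v)) (cj * (κ * ((Real.exp t : ℝ) : ℂ) ^ κ * besselMode a wj (Real.exp t) +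
          ((Real.exp t : ℝ) : ℂ) ^ κ * (Real.exp t : ℂ) * besselMode₁ a wj (Real.exp t))) t := by
        have h := (hasDerivAt_cpow_mul_besselMode_exp ha κ wj t).const_mul cj
        have hfun : (fun s : ℝ => ℓ (A[s] v)) = fun s : ℝ => cj * (((Real.exp s : ℝ) : ℂ) ^ κ * besselMode a wj (Real.exp s)) :=
          funext hf
        rw [hfun]
        exact h
      exact h1.unique h2
    have hf₂ : ℓ (A[y] (D Hc (D Hc v))) = cj * (κ ^ 2 * ((Real.exp y : ℝ) : ℂ) ^ κ * besselMode a wj (Real.exp y) +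
        (2 * κ + 1) * ((Real.exp y : ℝ) : ℂ) ^ κ * (Real.exp y : ℂ) * besselMode₁ a wj (Real.exp y) +
          ((Real.exp y : ℝ) : ℂ) ^ κ * (Real.exp y : ℂ) ^ 2 *
            (((a : ℂ) ^ 2 - (wj ^ 2 + 1 / 4) / (Real.exp y : ℂ) ^ 2) * besselMode a wj (Real.exp y))) := by
      have h1 : HasDerivAt (fun s : ℝ => ℓ (A[s] (D Hc v))) (ℓ (A[y] (D Hc (D Hc v)))) y :=
        hasDerivAt_apply_gardingAct_expGLC hτ w hℓ (D Hc v) y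
      have h2 : HasDerivAt (fun s : ℝ => ℓ (A[s] (D Hc v))) (cj * (κ ^ 2 * ((Real.exp y : ℝ) : ℂ) ^ κ * besselMode a wj (Real.exp y) +
          (2 * κ + 1) * ((Real.exp y : ℝ) : ℂ) ^ κ * (Real.exp y : ℂ) * besselMode₁ a wj (Real.exp y) +
            ((Real.exp y : ℝ) : ℂ) ^ κ * (Real.exp y : ℂ) ^ 2 *
              (((a : ℂ) ^ 2 - (wj ^ 2 + 1 / 4) / (Real.exp y : ℂ) ^ 2) * besselMode a wj (Real.exp y)))) y := by
        have h := (hasDerivAt_cpow_mul_besselMode_exp₁ ha κ wj y).const_mul cj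
        have hfun : (fun s : ℝ => ℓ (A[s] (D Hc v))) = fun s : ℝ => cj * (κ * (((Real.exp s : ℝ) : ℂ) ^ κ * besselMode a wj (Real.exp s)) +
            ((Real.exp s : ℝ) : ℂ) ^ κ * (Real.exp s : ℂ) * besselMode₁ a wj (Real.exp s)) := by
          funext s; rw [hf₁ s]; ring
        rw [hfun]
        exact h
      exact h1.unique h2
    -- solve the recursion for `ℓ(τ(exp yH) F v)`
    have hθh : θ₁ - Complex.I * θ₂ ≠ 0 := by
      intro h0
      rw [h0, mul_zero] at hθa
      have : (a : ℂ) ^ 2 = 0 := by linear_combination hθa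
      exact (pow_ne_zero 2 (Complex.ofReal_ne_zero.mpr ha.ne')) this
    have hY : ((Real.exp y : ℝ) : ℂ) ≠ 0 := Complex.ofReal_ne_zero.mpr (Real.exp_pos y).ne'
    have ha0 : (a : ℂ) ≠ 0 := Complex.ofReal_ne_zero.mpr ha.ne'
    have hθ' : (θ₁ - Complex.I * θ₂) * (θ₁ + Complex.I * θ₂) = -((a : ℂ) ^ 2) := by rw [mul_comm]; exact hθa
    have halg := string_step_algebra (μ₁ := μ₁) (μ₂ := μ₂) (ν := ν) (m := (m : ℂ)) (j := (j : ℂ))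
      (P := ((Real.exp y : ℝ) : ℂ) ^ κ) (bm := besselMode a wj (Real.exp y)) (bm₁ := besselMode₁ a wj (Real.exp y))
      ha0 hθ' hY hκ hwj rfl hlamh rfl rfl rfl
    rw [hvs, Finset.prod_range_succ, ← mul_assoc c, ← hcj]
    -- `besselMode a (ν - i(j+1)) = besselMode a (wj - i)`
    have hord : ν - Complex.I * ((j + 1 : ℕ) : ℂ) = wj - Complex.I := by rw [hwj]; push_cast; ring
    rw [hord, besselMode_sub_I ha wj (Real.exp_pos y)]
    -- compare with the recursion
    rw [hf y, hf₁ y, hf₂] at hrec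
    have hden : 2 * (θ₁ - Complex.I * θ₂) * (Real.exp y : ℂ) ≠ 0 := mul_ne_zero (mul_ne_zero two_ne_zero hθh) hY
    have hsol : ℓ (A[y] ((Dh[1,0] - Da[0,1]) v)) =
        -(2 * (cj * (κ ^ 2 * ((Real.exp y : ℝ) : ℂ) ^ κ * besselMode a wj (Real.exp y) +
          (2 * κ + 1) * ((Real.exp y : ℝ) : ℂ) ^ κ * (Real.exp y : ℂ) * besselMode₁ a wj (Real.exp y) +
            ((Real.exp y : ℝ) : ℂ) ^ κ * (Real.exp y : ℂ) ^ 2 *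
              (((a : ℂ) ^ 2 - (wj ^ 2 + 1 / 4) / (Real.exp y : ℂ) ^ 2) * besselMode a wj (Real.exp y)))) -
          (2 * μ₁ - 2 * ((m : ℂ) - 2 * j) + 4) * (cj * (κ * ((Real.exp y : ℝ) : ℂ) ^ κ * besselMode a wj (Real.exp y) +
            ((Real.exp y : ℝ) : ℂ) ^ κ * (Real.exp y : ℂ) * besselMode₁ a wj (Real.exp y))) +
          (μ₁ ^ 2 - Complex.I * μ₁ * μ₂ - μ₂ ^ 2 / 2 + 2 * μ₁ + ((m : ℂ) - 2 * j) ^ 2 / 2 - μ₁ * ((m : ℂ) - 2 * j) -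
            2 * ((m : ℂ) - 2 * j) - lamh) * (cj * (((Real.exp y : ℝ) : ℂ) ^ κ * besselMode a wj (Real.exp y))) +
          2 * ((θ₁ - Complex.I * θ₂) * (θ₁ + Complex.I * θ₂)) * (Real.exp y : ℂ) ^ 2 *
            (cj * (((Real.exp y : ℝ) : ℂ) ^ κ * besselMode a wj (Real.exp y)))) /
          (2 * (θ₁ - Complex.I * θ₂) * (Real.exp y : ℂ)) :=
      eq_div_of_mul_eq hden (by linear_combination hrec)
    rw [hsol, div_eq_iff hden]
    linear_combination cj * halg

end Bessel

end Literature.NumberTheory.Automorphic
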